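import Literature.NumberTheory.EllipticCurves.KernelReductionInertiaProofs
import HarnessLib

/-!
# The kernel of reduction at a place of good ordinary reduction above `2`

`Proofs` file (theorems only, no definitions, no named facts), topic `NumberTheory/EllipticCurves`.
The `ℓ = 2` companion of `KernelReductionOrdinaryTorsionProofs` / `KernelReductionInertiaProofs`
(which assume `ℓ` odd, the Hasse invariant `A_ℓ` being defined through `Ψ₂²^{(ℓ-1)/2}`).  In
residue characteristic `2` the Hasse invariant of `y² + a₁xy + a₃y = x³ + ⋯` is `a₁`
(`j̃ ≠ 0 ↔ ã₁ ≠ 0`; Silverman *AEC* A.1.1(c), V.4.1 and Ex. V.5.7), and `ΨSq₂ = Ψ₂² =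
4x³ + b₂x² + 2b₄x + b₆ ≡ ā₁²x² + ā₃²` has degree `2 = 2² - 2` when `ā₁ ≠ 0`; the root count of
`KernelReductionOrdinaryTorsionProofs` (Newton polygon: `card_roots_filter_one_lt_valuation`,
`card_addSubgroup_le_pow_of_one_lt_valuation`) then applies verbatim:

* `natDegree_ΨSq_two_of_a₁_ne_zero` — in characteristic `2`, `deg ΨSq₂ = 2` when `a₁ ≠ 0`;
* `card_roots_ΨSq_two_filter_one_lt_valuation` — over a valued field with `w 2 < 1` and
  `w a₁ = 1`, `ΨSq₂` has exactly one root of valuation `> 1`;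
* `card_addSubgroup_le_two_pow_of_a₁` — a finite subgroup of the kernel of reduction killed by
  `2ᵐ` has at most `2ᵐ` elements;
* `WeierstrassCurve.card_map_smul_sub_geomTorsion_le_two_pow` — for `E/K` over a number field
  with a good model `M/𝓞_v` at `v ∣ 2` with `a₁(M) ∈ 𝓞_vˣ` and `τ` in an inertia group above
  `v`: `#((τ - 1) E[2ᵐ]) ≤ 2ᵐ` (as `card_map_smul_sub_geomTorsion_le_pow` for odd `ℓ`).

## References

* [SerreAbelianLadic1968] J.-P. Serre, *Abelian ℓ-adic representations and elliptic curves*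
  (1968), Ch. IV, A.2.2.
* [SilvermanAEC2009] J. H. Silverman, *The Arithmetic of Elliptic Curves*, 2nd ed., III.1,
  Appendix A Prop. 1.1(c), V.3.1, VII.2.1, VII.3.1.
-/

noncomputable section

open scoped Classical NNReal
open Polynomial

universe u

namespace Literature.NumberTheory.EllipticCurves

-- `_root_`: the import closure declares `Literature.NumberTheory.EllipticCurves.WeierstrassCurve.*`
open _root_.WeierstrassCurve

/-! ## `ΨSq₂` in characteristic `2` -/

/-- **In characteristic `2`, `ΨSq₂ = a₁²x² + a₃²`**, of degree `2` when `a₁ ≠ 0`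
(`Ψ₂² = 4x³ + b₂x² + 2b₄x + b₆`, `b₂ = a₁² + 4a₂`, `b₆ = a₃² + 4a₆`). [Silverman AEC III.1]
[folklore] -/
theorem natDegree_ΨSq_two_of_a₁_ne_zero {S : Type*} [CommRing S] [NoZeroDivisors S] [CharP S 2]
    (V : WeierstrassCurve S) (hA : V.a₁ ≠ 0) :
    V.ΨSq 2 = C (V.a₁ ^ 2) * X ^ 2 + C (V.a₃ ^ 2) ∧ (V.ΨSq 2).natDegree = 2 ∧ V.ΨSq 2 ≠ 0 := by
  have h2 : (2 : S) = 0 := CharP.cast_eq_zero S 2 ▸ Nat.cast_ofNat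
  have h4 : (4 : S) = 0 := by rw [show (4 : S) = 2 * 2 by norm_num, h2, mul_zero]
  have hΨ : V.ΨSq 2 = C (V.a₁ ^ 2) * X ^ 2 + C (V.a₃ ^ 2) := by
    rw [show (2 : ℤ) = ((2 : ℕ) : ℤ) by norm_num]
    change V.ΨSq 2 = _
    rw [ΨSq_two, Ψ₂Sq, b₂, b₄, b₆, h4, h2]
    simp only [map_zero, zero_mul, zero_add, add_zero]
  have ha : V.a₁ ^ 2 ≠ 0 := pow_ne_zero 2 hA
  have hdeg : (C (V.a₁ ^ 2) * X ^ 2 + C (V.a₃ ^ 2) : S[X]).natDegree = 2 := by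
    rw [natDegree_add_C, natDegree_C_mul_X_pow 2 _ ha]
  refine ⟨hΨ, hΨ ▸ hdeg, fun h0 ↦ ?_⟩
  rw [hΨ] at h0
  have := congrArg natDegree h0
  rw [hdeg, natDegree_zero] at this
  exact two_ne_zero this

/-! ## The root count and the subgroup bound over a valued field of residue characteristic `2` -/

section Valued

variable {L : Type u} [Field L] {w : Valuation L ℝ≥0} (V : WeierstrassCurve L)
  [hV : V.IsIntegral w.integer]

/-- **At an ordinary place above `2` (`w a₁ = 1`), `ΨSq₂` has exactly one root of valuation
`> 1`**, counted with multiplicity: `deg ΨSq₂ = 3` over `L` and the reduction `ā₁²x² + ā₃²`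
has degree `2` (`card_roots_filter_one_lt_valuation`). [cite: SerreAbelianLadic1968, IV A.2.2] -/
theorem card_roots_ΨSq_two_filter_one_lt_valuation [IsAlgClosed L] (h2w : w (2 : ℕ) < 1)
    (h2L : (2 : L) ≠ 0) (hA : w V.a₁ = 1) :
    Multiset.card ((V.ΨSq 2).roots.filter fun a => 1 < w a) = 1 := by
  obtain ⟨M, hM⟩ := hV.integral
  haveI : Fact (2 : ℕ).Prime := ⟨Nat.prime_two⟩
  haveI := charP_residueField_of_valuation_natCast_lt_one w h2w
  set res := IsLocalRing.residue w.integer with hres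
  have hA' : (M.map res).a₁ ≠ 0 := by
    rw [map_a₁, hres, residue_ne_zero_iff_valuation_eq_one]
    have e : ((M.a₁ : w.integer) : L) = V.a₁ := by rw [hM]; rfl
    rw [e]; exact hA
  obtain ⟨-, hres_deg, hres_ne⟩ := natDegree_ΨSq_two_of_a₁_ne_zero (M.map res) hA'
  rw [map_ΨSq] at hres_deg hres_ne
  have hVΨ : V.ΨSq 2 = (M.ΨSq 2).map (algebraMap w.integer L) := by
    rw [hM, baseChange, ← map_ΨSq]
  have hdeg : (M.ΨSq 2).natDegree = 3 := by
    rw [← natDegree_map_algebraMap_integer w, ← hVΨ]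
    have := V.natDegree_ΨSq (n := 2) (by exact_mod_cast h2L)
    simpa using this
  rw [hVΨ, card_roots_filter_one_lt_valuation w _ hres_ne, hres_deg, hdeg]

/-- **The kernel of reduction meets `E[2^∞]` in a group of rank `≤ 1` at an ordinary place above
`2`**: a finite subgroup of `V(L)` killed by `2ᵐ` whose affine points have `w x > 1` has at most
`2ᵐ` elements. [cite: SerreAbelianLadic1968, IV A.2.2] -/
theorem card_addSubgroup_le_two_pow_of_a₁ [IsAlgClosed L] (h2w : w (2 : ℕ) < 1)
    (h2L : (2 : L) ≠ 0) (hA : w V.a₁ = 1) (m : ℕ) (G : AddSubgroup V.toAffine.Point) [Finite G]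
    (h1 : ∀ x y h, Affine.Point.some x y h ∈ G → 1 < w x)
    (hm : ∀ P ∈ G, ((2 ^ m : ℕ) : ℤ) • P = 0) : Nat.card G ≤ 2 ^ m := by
  haveI : Fact (2 : ℕ).Prime := ⟨Nat.prime_two⟩
  have hΨ : V.ΨSq 2 ≠ 0 := V.ΨSq_ne_zero (n := 2) (by exact_mod_cast h2L)
  exact card_addSubgroup_le_pow_of_one_lt_valuation w V (ℓ := 2) hΨ
    (card_roots_ΨSq_two_filter_one_lt_valuation V h2w h2L hA).le (by norm_num) m G h1 hm

end Valued

end Literature.NumberTheory.EllipticCurves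

/-! ## Number fields: `(τ - 1) E[2ᵐ]` at a place of good ordinary reduction above `2` -/

namespace WeierstrassCurve

open Literature.NumberTheory.EllipticCurves Literature.NumberTheory.GaloisRepresentations Field
  IsDedekindDomain IsDedekindDomain.HeightOneSpectrum NumberField
open scoped NumberField

variable {K : Type u} [Field K] [NumberField K] (W : WeierstrassCurve K)

/-- **At a place of good ordinary reduction above `2`, `#((τ - 1) E[2ᵐ]) ≤ 2ᵐ` for every `τ` in
the inertia group.**  Hypotheses: `E/K` elliptic over a number field, `v ∣ 2` with a good model
`M/𝓞_v` (`C • E_{K_v} = M_{K_v}`, `Δ(M) ∈ 𝓞_vˣ`) which is ordinary: `a₁(M) ∈ 𝓞_vˣ` (the Hasse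
invariant in characteristic `2`); `𝔓 ∣ v`, `τ ∈ I_𝔓`.  Proof as for odd `ℓ`
(`card_map_smul_sub_geomTorsion_le_pow`): the image of `E[2ᵐ]` under `P ↦ P^τ - P`, transported
to `M(K̄_v)` (`exists_map_smul_sub_reducesToZero`), is a finite subgroup of the kernel of
reduction killed by `2ᵐ`. [cite: SerreAbelianLadic1968, IV A.2.2] -/
theorem card_map_smul_sub_geomTorsion_le_two_pow [W.IsElliptic] {v : HeightOneSpectrum (𝓞 K)}
    (h2v : (2 : 𝓞 K) ∈ v.asIdeal)
    {C : VariableChange (v.adicCompletion K)} {M : WeierstrassCurve (v.adicCompletionIntegers K)}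
    (hCM : C • W.baseChange (v.adicCompletion K) =
      M.map (algebraMap (v.adicCompletionIntegers K) (v.adicCompletion K))) (hΔ : IsUnit M.Δ)
    (hA : IsUnit M.a₁)
    {𝔓 : Ideal (absIntegers (𝓞 K) K)} (h𝔓 : 𝔓 ∈ v.primesAbove)
    {τ : absoluteGaloisGroup K} (hτ : τ ∈ 𝔓.inertia (absoluteGaloisGroup K)) (m : ℕ) :
    Nat.card ((geomTorsion W ((2 ^ m : ℕ) : ℤ)).map
      (DistribSMul.toAddMonoidHom (geomPoints W) τ - AddMonoidHom.id (geomPoints W))) ≤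
        2 ^ m := by
  obtain ⟨w, hw, hint, Ψ, hΨinj, hΨ⟩ := W.exists_map_smul_sub_reducesToZero hCM hΔ h𝔓 hτ
  haveI := hint
  set f : geomPoints W →+ geomPoints W :=
    DistribSMul.toAddMonoidHom (geomPoints W) τ - AddMonoidHom.id (geomPoints W) with hf
  set H := (geomTorsion W ((2 ^ m : ℕ) : ℤ)).map f with hH
  have h2m0 : ((2 ^ m : ℕ) : ℤ) ≠ 0 := by exact_mod_cast pow_ne_zero m two_ne_zero
  haveI : Finite (geomTorsion W ((2 ^ m : ℕ) : ℤ)) :=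
    finite_torsionPoints_holds W (AlgebraicClosure K) h2m0
  have hHfin : (H : Set (geomPoints W)).Finite := by
    rw [hH, AddSubgroup.coe_map]
    exact (Set.toFinite _).image f
  haveI : Finite H := hHfin.to_subtype
  set G := H.map Ψ with hG
  have hGfin : (G : Set ((M.map (algebraMap (v.adicCompletionIntegers K)
      (v.adicCompletion K))).baseChange (AlgebraicClosure (v.adicCompletion K))).toAffine.Point).Finite := by
    rw [hG, AddSubgroup.coe_map]
    exact hHfin.image Ψ
  haveI : Finite G := hGfin.to_subtype
  have hcard : Nat.card H = Nat.card G := Nat.card_congr (H.equivMapOfInjective Ψ hΨinj).toEquiv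
  rw [hcard]
  have h2L : (2 : AlgebraicClosure (v.adicCompletion K)) ≠ 0 := by
    rw [← map_ofNat (algebraMap K (AlgebraicClosure (v.adicCompletion K))) 2]
    exact (map_ne_zero_iff _ (algebraMap K _).injective).mpr two_ne_zero
  have h2v' : ((2 : ℕ) : 𝓞 K) ∈ v.asIdeal := by simpa using h2v
  have h2w : w ((2 : ℕ) : AlgebraicClosure (v.adicCompletion K)) < 1 :=
    spectralValuation_natCast_lt_one hw h2v'
  have hAw : w (((M.map (algebraMap (v.adicCompletionIntegers K) (v.adicCompletion K))).baseChange
      (AlgebraicClosure (v.adicCompletion K))).a₁) = 1 := by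
    rw [baseChange, map_a₁, map_a₁]
    exact spectralValuation_eq_one_of_isUnit hw hA
  refine card_addSubgroup_le_two_pow_of_a₁ _ h2w h2L hAw m G ?_ ?_
  · intro x y h hmem
    obtain ⟨Q, hQ, hQeq⟩ := AddSubgroup.mem_map.mp hmem
    obtain ⟨P, -, rfl⟩ := AddSubgroup.mem_map.mp hQ
    exact hΨ P x y h hQeq
  · intro Q hmem
    obtain ⟨Q', hQ', rfl⟩ := AddSubgroup.mem_map.mp hmem
    obtain ⟨P, hP, rfl⟩ := AddSubgroup.mem_map.mp hQ'
    have hP0 : ((2 ^ m : ℕ) : ℤ) • P = 0 := (Submodule.mem_torsionBy_iff _ P).mp hP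
    rw [← map_zsmul Ψ, ← map_zsmul f, hP0, map_zero, map_zero]

end WeierstrassCurve

end
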